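import Summits.FinalStateConjecture.FinalStateConjecture.Theorems.SwallowTheDatumUniversalWitnessFamilyStubPlugDataPlusFromOf
import HarnessLib

/-!
# Stub `stub_plugDataPlusSharp_of` of the line `Sketch` (crux `SwallowTheDatum.UniversalWitnessFamily`,
# item stmt-FinalStateConjecture-10051): PlugData⁺ with prescribed exterior mass and the SHARP socket scale

The registered stub `stub_plugDataPlusSharp_of`: literally the landed `stub_plugDataPlusFrom_of`
(`Theorems/SwallowTheDatumUniversalWitnessFamilyStubPlugDataPlusFromOf.lean`) with one conjunct of the conclusion sharpened,
`2λ < ρ₃` becoming `16384 λ < ρ₃`.  The datum is the same: a smooth datum on `ℝ³` solving the vacuum constraints EVERYWHERE,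
exactly time-symmetric isotropic Schwarzschild(`M`) beyond `ρ₃ < M/40`, and exactly `λ⁻²`·Schwarzschild(`λμ`) on
`{λ < |y| < 2λ}`, `0 < μ ≤ μ₀`; the sharp scale separation is what the bulk package already provides — `BulkAt` places the
central site with `‖c 0‖ + 64 s₀ < ρ₃/256`, `c 0 = 0`, i.e. `16384 s₀ < ρ₃`, and `λ := s 0`.  The proof is the landed one
verbatim (the public section lemmas `PlugDataPlus.exists_lumpCore`, `exists_sitesSurgery`, `exists_capEnd` of the landed file are
reused, not re-proved): fix `η` (`exists_isBump`), the thresholds `εo, μo` (`mot_apply`, the only entry point of the printed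
gluing theorem Mao–Oh–Tao Thm 1.7, which is a HYPOTHESIS here), the bulk threshold `μ′₀` at mass `M`, the lump mass
`m ≤ min μ₀ μ′₀`, the Brill–Lindquist bulk `B`; lump → sites → end; bookkeeping `λ := s 0`, `μ := m/64`.

References: Mao–Oh–Tao arXiv:2308.13031, Thm 1.7, Rem 1.9, 1.11; Brill–Lindquist, Phys. Rev. 131 (1963) 471; Bartnik–Isenberg 2004, §2.
-/
-- the doubled `FinalStateConjecture` path component is the summit/problem naming scheme, not a mistake
set_option linter.dupNamespace false
-- instance search through the nested operator type `E3 →L[ℝ] E3 →L[ℝ] ℝ`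
set_option maxSynthPendingDepth 3

noncomputable section
namespace Summit.FinalStateConjecture.FinalStateConjecture.Theorems.SwallowTheDatum.UniversalWitnessFamily

open scoped Manifold ContDiff Topology BigOperators InnerProductSpace
open Set Filter Function Literature.Geometry.Lorentzian Literature.Geometry.Lorentzian.MaoOhTao
  Literature.Geometry.Lorentzian.InitialDataSet
open Summit.FinalStateConjecture.FinalStateConjecture.Theorems.SwallowTheDatum.ParametricKerrBurial
open PlugDataPlus

/-- **Stub `stub_plugDataPlusSharp_of`: PlugData⁺ with prescribed exterior mass `M` and sharp socket scale `16384 λ < ρ₃`.**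
From the printed gluing theorem of Mao–Oh–Tao (hypothesis `ObstructionFreeAnnularGluing`), the capping statement `CapEndAt`,
the flat and smoothed-Schwarzschild model data, the Schwarzschild OUT-site and the Brill–Lindquist bulk (for every `M`, all
sufficiently small core masses), for every compactness bound `μ₀ > 0` and every `M > 0`: a datum `D₀` on `ℝ³` solving the
vacuum constraints everywhere, exactly isotropic Schwarzschild(`M`) with `k = 0` beyond `ρ₃ < M/40`, and exactly
`λ⁻²(1 + λμ/2|y|)⁴ δ`, `k = 0` on `{λ < |y| < 2λ}`, `16384 λ < ρ₃`, `0 < μ ≤ μ₀` — the gluing theorem applied `N + 3` times at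
unit scale (lump, `N + 1` sites, end) with `λ := s 0`, `μ := m/64`; the sharp separation is `‖c 0‖ + 64 s₀ < ρ₃/256` of the
bulk package at the central site `c 0 = 0`. [cite: MaoOhTao2023, Thm 1.7] -/
theorem stub_plugDataPlusSharp_of :
  ObstructionFreeAnnularGluing →
    (∀ (M ρ₃ X₃ : ℝ), 0 < M → 0 < ρ₃ → 0 < X₃ → X₃ * ρ₃ = (M / 2) ^ 2 →
      ∀ G : InitialDataSet (𝓡 3) E3, CapEndAt M ρ₃ X₃ G) →
    (∃ F : InitialDataSet (𝓡 3) E3, FlatVacuumDatum F) →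
    (∀ m : ℝ, 0 < m → ∃ S : InitialDataSet (𝓡 3) E3, SchwDatum m S) →
    (∀ η : ℝ → ℝ, IsBump η → ∀ (εo μo μ₀ : ℝ), 0 < εo → 0 < μo → 0 < μ₀ →
      ∃ (m sOut θ : ℝ), 0 < m ∧ m ≤ μ₀ ∧ 0 < θ ∧ SchwOutSite η εo μo m sOut θ) →
    (∀ η : ℝ → ℝ, IsBump η → ∀ (εo μo M : ℝ), 0 < εo → 0 < μo → 0 < M →
      ∃ μ'₀ : ℝ, 0 < μ'₀ ∧ ∀ μ' : ℝ, 0 < μ' → μ' ≤ μ'₀ → BulkAt η εo μo M μ') →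
    ∀ μ₀ : ℝ, 0 < μ₀ → ∀ M : ℝ, 0 < M →
      ∃ (μ ρ₃ lam : ℝ) (D₀ : InitialDataSet (𝓡 3) E3),
        0 < μ ∧ μ ≤ μ₀ ∧ 0 < ρ₃ ∧ ρ₃ < M / 40 ∧ 0 < lam ∧ 16384 * lam < ρ₃ ∧
        (∀ [D₀.metric.HasLeviCivita], D₀.IsVacuumConstraintSolution) ∧
        (∀ y : E3, ρ₃ < ‖y‖ →
          (∀ v w : E3, D₀.h.inner y v w = Schwarzschild.conformalFactor M y ^ 4 * ⟪v, w⟫_ℝ) ∧ D₀.k y = 0) ∧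
        (∀ y : E3, lam < ‖y‖ → ‖y‖ < 2 * lam →
          (∀ v w : E3, D₀.h.inner y v w = (lam ^ 2)⁻¹ * (1 + lam * μ / (2 * ‖y‖)) ^ 4 * ⟪v, w⟫_ℝ) ∧
            D₀.k y = 0) := by
  intro hMOT hcap hFex hSex hsite hbulk μ₀ hμ₀ M hM
  -- §0 parameters
  obtain ⟨η, hη⟩ := ParametricKerrBurial.exists_isBump
  obtain ⟨εo, μo, hεo, hμo, hmot⟩ := mot_apply hMOT hη
  obtain ⟨μ'₀, hμ'₀, hbulk'⟩ := hbulk η hη εo μo M hεo hμo hM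
  obtain ⟨m, sOutS, θ, hm, hmle, hθ, hsiteS⟩ := hsite η hη εo μo (min μ₀ μ'₀) hεo hμo (lt_min hμ₀ hμ'₀)
  obtain ⟨ρ₃, X₃, N, c, s, sOut, sIn₀, sM, sEnd, B, hρ₃, hρ₃M, hX₃, hX₃ρ₃, hc0, hs, hcs, hsep, -, hBvac, hHj, -, hH0, -,
    hHend⟩ := hbulk' m hm (hmle.trans (min_le_right _ _))
  obtain ⟨F, hF⟩ := hFex
  obtain ⟨S, hS⟩ := hSex m hm
  obtain ⟨Se, hSe⟩ := hSex (M / X₃) (div_pos hM hX₃)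
  -- §1 the lump, read at scale `64`
  obtain ⟨Gr₀, hGr₀vac, hGr₀f⟩ := exists_lumpCore hmot hF hS (motHyp_flat_of_schwOutSite hsiteS hθ hS)
  -- §2 the sites: in-data `Gr₀` at the centre, the flat core elsewhere
  classical
  let Din : Fin (N + 1) → InitialDataSet (𝓡 3) E3 := fun j ↦ if j = 0 then Gr₀ else F
  let sIn : Fin (N + 1) → ℝ := fun j ↦ if j = 0 then sIn₀ else 0
  have hDin0 : Din 0 = Gr₀ := if_pos rfl
  have hDinvac : ∀ j (y : E3), ‖y‖ < 2 → VacAt (Din j) y := by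
    intro j
    by_cases hj : j = 0
    · rw [show Din j = Gr₀ from if_pos hj]
      exact fun y _ ↦ hGr₀vac y
    · rw [show Din j = F from if_neg hj]
      exact fun y _ ↦ hF.2 y
  have hHj' : ∀ j, MOTHyp η εo μo (Din j).coordH (Din j).coordK (fun y ↦ (s j) ^ 2 • B.coordH (c j + s j • y))
      (fun y ↦ (s j) ^ 2 • B.coordK (c j + s j • y)) (sIn j) (sOut j) := by
    intro j
    by_cases hj : j = 0
    · subst hj
      simp only [Din, sIn, if_true]
      exact motHyp_congr hη (isOpen_outside_zero (1 / 2)) isOpen_univ (fun x h1 _ ↦ show 1 / 2 < ‖x‖ by linarith)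
        (fun x _ _ ↦ mem_univ x) (fun x hx ↦ (hGr₀f x hx).1) (fun x hx ↦ (hGr₀f x hx).2) (fun x _ ↦ rfl)
        (fun x _ ↦ rfl) hH0
    · simp only [Din, sIn, hj, if_false]
      rw [coordH_eq_flatField hF, coordK_eq_zeroField hF]
      exact hHj j hj
  obtain ⟨G, hGvac, hGB, hGsock⟩ := exists_sitesSurgery hmot B Din c s sIn sOut hs hsep hBvac hDinvac hHj'
  -- `G = B` beyond `ρ₃/256`
  have hGB' : ∀ y : E3, ρ₃ / 256 ≤ ‖y‖ → G.SameAt B y := fun y hy ↦ hGB y fun j ↦ by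
    have h1 := hcs j
    have h2 : ‖y‖ ≤ ‖y - c j‖ + ‖c j‖ := by
      calc ‖y‖ = ‖(y - c j) + c j‖ := by rw [sub_add_cancel]
        _ ≤ ‖y - c j‖ + ‖c j‖ := norm_add_le _ _
    linarith [hs j]
  -- §3 the end
  obtain ⟨P, hPvac, hPext, hPG⟩ :=
    exists_capEnd hη hmot hρ₃ (hcap M ρ₃ X₃ hM hρ₃ hX₃ hX₃ρ₃) hSe hGvac hGB' hHend
  -- §4 bookkeeping: the sharp separation `16384 s₀ < ρ₃` is `‖c 0‖ + 64 s₀ < ρ₃/256` at the central site `c 0 = 0`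
  have hs0 := hs 0
  have hc64 : 64 * s 0 < ρ₃ / 256 := by
    have := hcs 0
    rw [hc0, norm_zero, zero_add] at this
    exact this
  refine ⟨m / 64, ρ₃, s 0, P, by positivity, ?_, hρ₃, hρ₃M, hs0, by linarith,
    isVacuumConstraintSolution_of_vacAt hPvac, fun y hy ↦ hPext y (by linarith), fun y hy1 hy2 ↦ ?_⟩
  · have : m ≤ μ₀ := hmle.trans (min_le_left _ _)
    linarith
  · -- the socket annulus `{s 0 < |y| < 2 s 0}` reads `Gr₀` at scale `s 0`
    obtain ⟨hh, hk⟩ := hPG y (by linarith)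
    have hyc : ‖y - c 0‖ < 2 * s 0 := by rwa [hc0, sub_zero]
    have hyn : 0 < ‖y‖ := by linarith
    have hy' : 1 / 2 < ‖(s 0)⁻¹ • (y - c 0)‖ := by
      rw [hc0, sub_zero, norm_smul, Real.norm_eq_abs, abs_of_pos (inv_pos.2 hs0), lt_inv_mul_iff₀ hs0]
      linarith
    obtain ⟨hGrH, hGrK⟩ := hGr₀f _ hy'
    have hs2 : (s 0) ^ 2 ≠ 0 := pow_ne_zero 2 hs0.ne'
    refine ⟨fun v w ↦ ?_, ?_⟩
    · obtain ⟨e1, -⟩ := hGsock 0 y v w hyc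
      rw [hDin0] at e1
      have e2 : Gr₀.h.inner ((s 0)⁻¹ • (y - c 0)) v w = schwField (m / 64) ((s 0)⁻¹ • (y - c 0)) v w := by
        rw [← coordH_apply, hGrH]
      rw [show P.h.inner y v w = G.h.inner y v w by rw [hh], ← inv_mul_cancel_left₀ hs2 (G.h.inner y v w), e1, e2,
        schwField_apply, hc0, sub_zero, norm_smul, Real.norm_eq_abs, abs_of_pos (inv_pos.2 hs0)]
      rw [show m / 64 / (2 * ((s 0)⁻¹ * ‖y‖)) = s 0 * (m / 64) / (2 * ‖y‖) by field_simp]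
      ring
    · ext v w
      obtain ⟨-, e1⟩ := hGsock 0 y v w hyc
      rw [hDin0] at e1
      have e2 : Gr₀.k ((s 0)⁻¹ • (y - c 0)) v w = 0 := by
        rw [← coordK_apply, hGrK]
        rfl
      have h0 : G.k y v w = 0 := (mul_eq_zero.1 (e1.trans e2)).resolve_left hs2
      rw [show P.k y v w = G.k y v w by rw [hk], h0]
      rfl

end Summit.FinalStateConjecture.FinalStateConjecture.Theorems.SwallowTheDatum.UniversalWitnessFamily

end
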